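import Mathlib.AlgebraicTopology.FundamentalGroupoid.SimplyConnected
import Literature.AlgebraicTopology.FundamentalGroup.VanKampenKernel
import HarnessLib

/-!
# Simple connectivity through push-offs and retractions along a flow

Topic `Literature/AlgebraicTopology/FundamentalGroup`.  Two elementary criteria of homotopy
theory, written for subsets `A ⊆ S ⊆ U` of a topological space `X` and an "obstruction" set
`K ⊆ X` (think: `U` an open slab of a Morse function on a cobordism, `S` a closed sub-slab, `A`
its part below a regular level, `K` the union of the unstable manifolds of the critical points
between; Milnor, *Lectures on the h-cobordism theorem* (1965), Remark 1 after Thm. 6.4 and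
proof of Thm. 8.1, where the same conclusions are drawn from Thm. 3.14 and van Kampen's
theorem):

* `isSimplyConnected_of_flowRetraction` — **`A` simply connected ⇒ `S` simply connected**,
  GIVEN: every loop in `S` based in `A` can be pushed off `K` by a homotopy inside `U`
  (general position), a deformation `H` of `U ∖ K` inside `U` into `A` fixing `A` (the flow to
  the level), and a retraction `ρ : U → S` (so that homotopies in `U` give homotopies in `S`),
  plus: every point of `S` is joined inside `S` to a point of `A`.
* `isSimplyConnected_of_retraction` — **`S` simply connected ⇒ `A` simply connected**, GIVEN:
  paths in `S` between points of `A` can be replaced by paths in `U ∖ K`, null-homotopies in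
  `S` of loops in `A` by null-homotopies in `U ∖ K` with the same boundary values (general
  position for discs), and a retraction `R : U ∖ K → A`.

Also small API for `Literature.AlgebraicTopology.FundamentalGroup.VanKampen.HomotopicWithin`
(`VanKampenKernel.lean`): reflexivity, symmetry, transitivity, monotonicity, transport along a
partially defined retraction, and the change of base point for null-homotopic loops.
Everything is proved (`[folklore]`); no definitions.

## References

* A. Hatcher, *Algebraic Topology*, CUP (2002), §1.1 (change of base point, Prop. 1.5),
  Prop. 1.17 (deformation retractions induce isomorphisms on `π₁`). [HatcherAT2002]
* J. Milnor, *Lectures on the h-cobordism theorem*, Princeton (1965), Remark 1 after Thm. 6.4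
  (PDF p. 38), proof of Thm. 8.1 (PDF p. 56). [MilnorHCobordism1965]
-/

noncomputable section

open Set Function Topology unitInterval

namespace Literature.AlgebraicTopology.FundamentalGroup

namespace VanKampen

variable {Y : Type*} [TopologicalSpace Y]

/-- A path inside `S` is homotopic within `S` to itself. [folklore] -/
theorem HomotopicWithin.refl {S : Set Y} {a b : Y} (p : Path a b) (hp : ∀ t, p t ∈ S) :
    HomotopicWithin S p p :=
  ⟨Path.Homotopy.refl p, fun x => hp x.2⟩

/-- Symmetry of homotopy within `S`. [folklore] -/
theorem HomotopicWithin.symm {S : Set Y} {a b : Y} {p q : Path a b} (h : HomotopicWithin S p q) :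
    HomotopicWithin S q p := by
  obtain ⟨F, hF⟩ := h
  exact ⟨F.symm, fun x => hF _⟩

/-- Transitivity of homotopy within `S`. [folklore] -/
theorem HomotopicWithin.trans {S : Set Y} {a b : Y} {p q r : Path a b}
    (h₁ : HomotopicWithin S p q) (h₂ : HomotopicWithin S q r) : HomotopicWithin S p r := by
  obtain ⟨F, hF⟩ := h₁
  obtain ⟨G, hG⟩ := h₂
  refine ⟨F.trans G, fun x => ?_⟩
  rw [Path.Homotopy.trans_apply]
  split_ifs
  · exact hF _
  · exact hG _

/-- Monotonicity of homotopy within a set. [folklore] -/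
theorem HomotopicWithin.mono {S T : Set Y} (hST : S ⊆ T) {a b : Y} {p q : Path a b}
    (h : HomotopicWithin S p q) : HomotopicWithin T p q := by
  obtain ⟨F, hF⟩ := h
  exact ⟨F, fun x => hST (hF x)⟩

/-- **Transport along a retraction.**  If `p ≃ q` within `U`, and `ρ` is continuous on `U`
with values in `S` and fixes the points of `p` and `q`, then `p ≃ q` within `S` (compose the
homotopy with `ρ`). [folklore] -/
theorem HomotopicWithin.of_retraction {U S : Set Y} {a b : Y} {p q : Path a b}
    (h : HomotopicWithin U p q) (ρ : Y → Y) (hρ : ContinuousOn ρ U) (hρS : MapsTo ρ U S)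
    (hp : ∀ t, ρ (p t) = p t) (hq : ∀ t, ρ (q t) = q t) : HomotopicWithin S p q := by
  obtain ⟨F, hF⟩ := h
  refine ⟨{ toFun := fun x => ρ (F x)
            continuous_toFun := hρ.comp_continuous F.continuous hF
            map_zero_left := fun t => by
              change ρ (F (0, t)) = p t
              rw [F.apply_zero]; exact hp t
            map_one_left := fun t => by
              change ρ (F (1, t)) = q t
              rw [F.apply_one]; exact hq t
            prop' := fun s t ht => by
              change ρ (F (s, t)) = p t
              rw [F.eq_fst s ht]; exact hp t }, fun x => hρS (hF x)⟩

/-- A path of the subspace `S`, mapped to `Y` and lifted back, is itself. [folklore] -/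
theorem liftPath_map_val {S : Set Y} {a b : S} (P : Path a b) :
    liftPath S (P.map continuous_subtype_val) (fun t => (P t).2) = P := by
  ext t; rfl

/-- **Change of base point for null-homotopic loops.**  If `x` is joined to `a` by a path and
every loop at `a` is null-homotopic, then every loop at `x` is null-homotopic
(`[q⁻¹ · γ · q] = 1 ⇒ [γ] = 1` in the fundamental groupoid; Hatcher, Prop. 1.5). [folklore] -/
theorem homotopic_refl_of_forall_loop {x a : Y} (q : Path x a)
    (h : ∀ ℓ : Path a a, ℓ.Homotopic (Path.refl a)) (γ : Path x x) :
    γ.Homotopic (Path.refl x) := by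
  have hL := h ((q.symm.trans γ).trans q)
  rw [← Path.Homotopic.Quotient.eq] at hL ⊢
  simp only [Path.Homotopic.Quotient.mk_trans, Path.Homotopic.Quotient.mk_symm,
    Path.Homotopic.Quotient.mk_refl] at hL ⊢
  have h1 : (Path.Homotopic.Quotient.mk q).symm.trans (Path.Homotopic.Quotient.mk γ) =
      (Path.Homotopic.Quotient.mk q).symm := by
    have := congrArg (fun P => P.trans (Path.Homotopic.Quotient.mk q).symm) hL
    simpa only [Path.Homotopic.Quotient.trans_assoc, Path.Homotopic.Quotient.trans_symm,
      Path.Homotopic.Quotient.trans_refl, Path.Homotopic.Quotient.refl_trans] using this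
  have h2 := congrArg (fun P => (Path.Homotopic.Quotient.mk q).trans P) h1
  simpa only [trans_symm_cancel, Path.Homotopic.Quotient.trans_symm] using h2

/-- **Loops at base points of `A` suffice.**  If every point of `S ⊆ Y` is joined inside `S`
to some point of `A`, and all loops inside `S` at points of `A` are null-homotopic within `S`,
then every loop inside `S` is null-homotopic within `S` (change of base point in the subspace
`S`). [folklore] -/
theorem exists_homotopy_refl_of_joinedIn {S A : Set Y}
    (hA : ∀ a ∈ A, ∀ ℓ : Path a a, (∀ t, ℓ t ∈ S) → HomotopicWithin S ℓ (Path.refl a))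
    (hjoin : ∀ x ∈ S, ∃ a ∈ A, JoinedIn S x a) {x : Y} (p : Path x x) (hp : ∀ t, p t ∈ S) :
    ∃ F : p.Homotopy (Path.refl x), ∀ t, F t ∈ S := by
  have hx : x ∈ S := p.source ▸ hp 0
  obtain ⟨a, ha, hxa⟩ := hjoin x hx
  set q : Path x a := hxa.somePath with hq_def
  have hq : ∀ t, q t ∈ S := hxa.somePath_mem
  -- in the subspace `S`
  let Q := liftPath S q hq
  let P := liftPath S p hp
  have hloops : ∀ ℓ : Path (⟨a, q.target ▸ hq 1⟩ : S) ⟨a, q.target ▸ hq 1⟩,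
      ℓ.Homotopic (Path.refl _) := by
    intro ℓ
    have hℓS : ∀ t, (ℓ.map continuous_subtype_val) t ∈ S := fun t => (ℓ t).2
    have haS : a ∈ S := by simpa using hq 1
    have h := (hA a ha (ℓ.map continuous_subtype_val) hℓS).liftPath hℓS (fun _ => haS)
    rw [liftPath_map_val] at h
    exact h
  have hP : P.Homotopic (Path.refl _) := homotopic_refl_of_forall_loop Q hloops P
  obtain ⟨F⟩ := hP
  exact ⟨F.map (.restrict S (.id _)), fun t => (F t).2⟩

end VanKampen

open VanKampen

variable {X : Type*} [TopologicalSpace X]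

/-- **`π₁(A) = 1 ⇒ π₁(S) = 1` through a flow retraction and general position** (the
surjectivity half of "attaching cells of dimension `≥ 2` does not change `π₁`", Hatcher
Prop. 1.26 (a), in flow form).  Let `A ⊆ S ⊆ U ⊆ X` and `K ⊆ X` with `A ∩ K = ∅`.  Suppose:
every point of `S` is joined inside `S` to a point of `A`; every loop inside `S` based at a
point of `A` is homotopic within `U` to a loop avoiding `K`; there is a deformation `H` of
`U ∖ K`, continuous on `[0, 1] × (U ∖ K)`, with `H₀ = id`, `H_t(U ∖ K) ⊆ U`, `H₁(U ∖ K) ⊆ A`,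
fixing `A` pointwise; and there is a retraction `ρ` of `U` onto `S` (continuous on `U`, values
in `S`, identity on `S`).  If `A` is simply connected, so is `S`: a loop in `S` at `a ∈ A` is
pushed off `K` inside `U`, flowed into `A` by `H`, contracted in `A`, and the resulting
null-homotopy in `U` is retracted into `S` by `ρ`; other base points by change of base point.
[folklore] -/
theorem isSimplyConnected_of_flowRetraction {A S U K : Set X} (hAS : A ⊆ S) (hSU : S ⊆ U)
    (hA : IsSimplyConnected A) (hjoin : ∀ x ∈ S, ∃ a ∈ A, JoinedIn S x a)
    (hpush : ∀ ⦃a : X⦄ (γ : Path a a), a ∈ A → (∀ t, γ t ∈ S) →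
      ∃ γ' : Path a a, (∀ t, γ' t ∉ K) ∧ HomotopicWithin U γ γ')
    (H : I × X → X) (hHc : ContinuousOn H (univ ×ˢ (U \ K)))
    (hH0 : ∀ x ∈ U \ K, H (0, x) = x) (hHU : ∀ x ∈ U \ K, ∀ t, H (t, x) ∈ U)
    (hH1 : ∀ x ∈ U \ K, H (1, x) ∈ A) (hHA : ∀ a ∈ A, ∀ t, H (t, a) = a)
    (ρ : X → X) (hρ : ContinuousOn ρ U) (hρS : MapsTo ρ U S) (hρid : ∀ x ∈ S, ρ x = x) :
    IsSimplyConnected S := by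
  obtain ⟨hApc, hAloops⟩ := isSimplyConnected_iff_exists_homotopy_refl_forall_mem.1 hA
  -- Main claim: loops inside `S` at points of `A` are null within `S`.
  have main : ∀ a ∈ A, ∀ ℓ : Path a a, (∀ t, ℓ t ∈ S) → HomotopicWithin S ℓ (Path.refl a) := by
    intro a ha ℓ hℓ
    obtain ⟨γ', hγ'K, hγ'⟩ := hpush ℓ ha hℓ
    have hγ'U : ∀ t, γ' t ∈ U := hγ'.right_mem
    have hmem : ∀ t, γ' t ∈ U \ K := fun t => ⟨hγ'U t, hγ'K t⟩
    have haUK : a ∈ U \ K := γ'.source ▸ hmem 0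
    -- flow `γ'` into `A`
    let γ'' : Path a a :=
      { toFun := fun t => H (1, γ' t)
        continuous_toFun := hHc.comp_continuous (by fun_prop) fun t => ⟨mem_univ _, hmem t⟩
        source' := by rw [γ'.source]; exact hHA a ha 1
        target' := by rw [γ'.target]; exact hHA a ha 1 }
    have h2 : HomotopicWithin U γ' γ'' := by
      refine ⟨{ toFun := fun p => H (p.1, γ' p.2)
                continuous_toFun := hHc.comp_continuous (by fun_prop) fun p => ⟨mem_univ _, hmem _⟩
                map_zero_left := fun t => hH0 _ (hmem t)
                map_one_left := fun t => rfl
                prop' := fun s t ht => ?_ }, fun p => hHU _ (hmem _) _⟩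
      change H (s, γ' t) = γ' t
      rcases ht with rfl | rfl
      · rw [γ'.source]; exact hHA a ha s
      · rw [γ'.target]; exact hHA a ha s
    have h3 : HomotopicWithin U γ'' (Path.refl a) := by
      obtain ⟨F, hF⟩ := hAloops a γ'' fun t => hH1 _ (hmem t)
      exact HomotopicWithin.mono (hAS.trans hSU) ⟨F, hF⟩
    have h4 : HomotopicWithin U ℓ (Path.refl a) := (hγ'.trans h2).trans h3
    exact h4.of_retraction ρ hρ hρS (fun t => hρid _ (hℓ t)) fun _ => hρid a (hAS ha)
  refine isSimplyConnected_iff_exists_homotopy_refl_forall_mem.2 ⟨?_, fun x p hp => ?_⟩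
  · -- path connectedness
    obtain ⟨a₀, ha₀⟩ := hA.nonempty
    refine ⟨a₀, hAS ha₀, fun y hy => ?_⟩
    obtain ⟨a, ha, hya⟩ := hjoin y hy
    exact ((hApc.joinedIn a₀ ha₀ a ha).mono hAS).trans hya.symm
  · exact exists_homotopy_refl_of_joinedIn main hjoin p hp

/-- **`π₁(S) = 1 ⇒ π₁(A) = 1` through a retraction and general position** (the injectivity
half, "attaching cells of dimension `≥ 3` does not change `π₁`", Hatcher Prop. 1.26 (b), in flow
form).  Let `A ⊆ S ⊆ U ⊆ X`, `K ⊆ X`, `A` nonempty.  Suppose: every path inside `S` between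
points of `A` can be replaced by a path inside `U ∖ K` with the same ends; every null-homotopy
inside `S` of a loop inside `A` can be replaced by a null-homotopy inside `U ∖ K` of the same
loop; and there is a retraction `R` of `U ∖ K` onto `A` (continuous on `U ∖ K`, values in `A`,
identity on `A`).  If `S` is simply connected, so is `A`. [folklore] -/
theorem isSimplyConnected_of_retraction {A S U K : Set X} (hAS : A ⊆ S) (hAne : A.Nonempty)
    (hS : IsSimplyConnected S)
    (hpush₁ : ∀ ⦃x y : X⦄ (γ : Path x y), x ∈ A → y ∈ A → (∀ t, γ t ∈ S) →
      ∃ γ' : Path x y, ∀ t, γ' t ∈ U ∧ γ' t ∉ K)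
    (hpush₂ : ∀ ⦃a : X⦄ (γ : Path a a) (F : γ.Homotopy (Path.refl a)), a ∈ A →
      (∀ t, γ t ∈ A) → (∀ st, F st ∈ S) →
      ∃ G : γ.Homotopy (Path.refl a), ∀ st, G st ∈ U ∧ G st ∉ K)
    (R : X → X) (hRc : ContinuousOn R (U \ K)) (hRA : MapsTo R (U \ K) A)
    (hRid : ∀ a ∈ A, R a = a) : IsSimplyConnected A := by
  obtain ⟨hSpc, hSloops⟩ := isSimplyConnected_iff_exists_homotopy_refl_forall_mem.1 hS
  refine isSimplyConnected_iff_exists_homotopy_refl_forall_mem.2 ⟨?_, fun x p hp => ?_⟩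
  · -- path connectedness: join in `S`, push off `K`, retract
    obtain ⟨a₀, ha₀⟩ := hAne
    refine ⟨a₀, ha₀, fun y hy => ?_⟩
    have hj : JoinedIn S a₀ y := hSpc.joinedIn a₀ (hAS ha₀) y (hAS hy)
    obtain ⟨γ', hγ'⟩ := hpush₁ hj.somePath ha₀ hy hj.somePath_mem
    let δ : Path a₀ y :=
      { toFun := fun t => R (γ' t)
        continuous_toFun := hRc.comp_continuous γ'.continuous fun t => ⟨(hγ' t).1, (hγ' t).2⟩
        source' := by rw [γ'.source]; exact hRid a₀ ha₀
        target' := by rw [γ'.target]; exact hRid y hy }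
    exact ⟨δ, fun t => hRA ⟨(hγ' t).1, (hγ' t).2⟩⟩
  · -- loops: contract in `S`, push the disc off `K`, retract
    have hx : x ∈ A := p.source ▸ hp 0
    obtain ⟨F, hF⟩ := hSloops x p fun t => hAS (hp t)
    obtain ⟨G, hG⟩ := hpush₂ p F hx hp hF
    refine ⟨{ toFun := fun st => R (G st)
              continuous_toFun := hRc.comp_continuous G.continuous fun st => ⟨(hG st).1, (hG st).2⟩
              map_zero_left := fun t => by
                change R (G (0, t)) = p t
                rw [G.apply_zero]; exact hRid _ (hp t)
              map_one_left := fun t => by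
                change R (G (1, t)) = (Path.refl x) t
                rw [G.apply_one]; exact hRid x hx
              prop' := fun s t ht => by
                change R (G (s, t)) = p t
                rw [G.eq_fst s ht]; exact hRid _ (hp t) }, fun st => hRA ⟨(hG st).1, (hG st).2⟩⟩

end Literature.AlgebraicTopology.FundamentalGroup
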